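import Mathlib
import Summits.Ventures.PercRepro2.Defs
import Summits.Ventures.PercRepro2.Graph
import Summits.Ventures.PercRepro2.OneColourSwitch
import Summits.Ventures.PercRepro2.RegionHubSign
import Summits.Ventures.PercRepro2.SideSwitch
import Summits.Ventures.PercRepro2.SideSwitchFibre
import Summits.Ventures.PercRepro2.SideSwitchClosed
import Summits.Ventures.PercRepro2.SideSwitchComps
import Summits.Ventures.PercRepro2.M9NoPocketDefs
import Summits.Ventures.PercRepro2.M9NoPocketWorld
import Summits.Ventures.PercRepro2.M9NoPocketFibre
import Summits.Ventures.PercRepro2.M9NoPocketCompl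
import Summits.Ventures.PercRepro2.M9RegionSplit
import Summits.Ventures.PercRepro2.M9PocketCubeDefs
import Summits.Ventures.PercRepro2.M9PocketCubeFibre
import Summits.Ventures.PercRepro2.M9PocketCubeCompl
import Summits.Ventures.PercRepro2.M9PocketCubeHub
import Summits.Ventures.PercRepro2.M9PocketCubeWorldMono
import Summits.Ventures.PercRepro2.M9DeadEnd
import Summits.Ventures.PercRepro2.M9DeadEndMono
import Summits.Ventures.PercRepro2.M9DeadEndHarris
import Summits.Ventures.PercRepro2.M9LinkedHubCube
import Summits.Ventures.PercRepro2.M9LinkedGroup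
import Summits.Ventures.PercRepro2.M9LinkedGroupClosed
import Summits.Ventures.PercRepro2.M9LinkedGroupLegal
import Summits.Ventures.PercRepro2.M9LinkedGroupAnti
import Summits.Ventures.PercRepro2.M9LinkedGroupTilt1
import Summits.Ventures.PercRepro2.M9DAvoidSplit
import Summits.Ventures.PercRepro2.M9PocketCubeFibre
import Summits.Ventures.PercRepro2.M9HarrisCube
import Summits.Ventures.PercRepro2.M9PocketCubeMono
import Summits.Ventures.PercRepro2.M9GeneralDSplit
import Summits.Ventures.PercRepro2.M9GeneralDHD
import Summits.Ventures.PercRepro2.M9LinkedHD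

/-!
# The tilt on a group interval, the fibration of the cube by the groups, and CLASS C7 closed
(blind cell PercRepro2, p3 g29, 2026-08-28; steps (v)–(vi) of the `Y`-pocket-group plan, part 2;
`proofs/P3-LINKED.md` §1–§2)

The group interval `[lo, hi]` is the image of the cube `{z ≤ c'}`, `c' = (hi.1, hi.2 ∖ lo.2)`, under
the shift `z ↦ (z.1, z.2 ∪ lo.2)`, which carries the cube complement to the group complement
(`groupShift_cornerDual`).  The tilt lemma of `M9HarrisCube` on `{z ≤ c'}`, with the indicator of
the `K`-side `HD ∧ r ~_Y s` region composed with the complement (monotone: the region is a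
down-set of the interval, `M9LinkedGroupAnti`) and the transfer of `M9LinkedGroupTilt1`, gives
**`Σ_{region} σ̃_pq ≤ 0`** (`groupRegion_sum_nonpos`).  The group interval and the region are
constant on the interval (`groupInterval_eq_of_mem`), so the `K`-side `HD ∧ r ~_Y s` points of the
cube of a representative are partitioned by their regions: **`Σ σ̃_pq ≤ 0`** over them
(`hdKY_cube_sum_nonpos`).  With `σ_pq ≤ σ̃_pq` on the `K`-side (`M9DAvoidSplit`) and the
fibration by representatives (`sum_dOne_eq_sum_repP_legalP`): **`hdKYSum ≤ 0`**
(`hdKYSum_nonpos`), the one lemma `M9LinkedHD` left open, and hence **CLASS C7**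
(`dSignSum_nonpos_of_linked`): if every `r–s` path avoiding `d` passes through a neighbour of `d`
(`Linked`), then `dSignSum ends p q r s d ≤ 0` — unconditional, Mathlib and the cell's own modules
only.  Own work; std axioms.
-/

namespace Summit.Ventures.PercRepro2

namespace NoPocket

open Finset Classical RegionHub OneColourSwitch SideSwitch TermSwitch

variable {V : Type*} {E : Type*}

section Tilt

variable [Fintype V] [DecidableEq V] [Fintype E] [DecidableEq E]

variable (ends : E → Sym2 V)

/-- The shifted corner of the group interval: the interval is the image of the cube `{z ≤ c'}`. -/
noncomputable def groupCorner (ends : E → Sym2 V) (d r s : V) (ρ : Config E)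
    (x : Finset (Finset V) × Finset E) :
    Finset (Finset V) × Finset E :=
  ((groupHi ends d r s ρ x).1, (groupHi ends d r s ρ x).2 \ (groupLo ends d r s ρ x).2)

/-- The shift from the cube `{z ≤ c'}` onto the group interval. -/
noncomputable def groupShift (ends : E → Sym2 V) (d r s : V) (ρ : Config E)
    (x z : Finset (Finset V) × Finset E) :
    Finset (Finset V) × Finset E :=
  (z.1, z.2 ∪ (groupLo ends d r s ρ x).2)

/-- The cube complement of `{z ≤ c'}`. -/
noncomputable def cornerDual (ends : E → Sym2 V) (d r s : V) (ρ : Config E)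
    (x z : Finset (Finset V) × Finset E) :
    Finset (Finset V) × Finset E :=
  ((groupCorner ends d r s ρ x).1 \ z.1, (groupCorner ends d r s ρ x).2 \ z.2)


variable {ends}

/-- The shift of a cube vector lies in the group interval. -/
lemma groupShift_mem_groupInterval {d r s : V} {ρ : Config E}
    {x z : Finset (Finset V) × Finset E} (hx : x ∈ cubeP ends d r s ρ)
    (hz : z ≤ groupCorner ends d r s ρ x) :
    groupShift ends d r s ρ x z ∈ groupInterval ends d r s ρ x := by
  obtain ⟨hT, hF⟩ := mem_cubeP.1 hx
  have h1 : z.1 ⊆ (groupHi ends d r s ρ x).1 := hz.1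
  have h2 : z.2 ⊆ (groupHi ends d r s ρ x).2 \ (groupLo ends d r s ρ x).2 := hz.2
  refine mem_groupInterval.2 ⟨?_, ⟨Finset.empty_subset _, Finset.subset_union_right⟩,
    h1, ?_⟩
  · refine mem_cubeP.2 ⟨h1.trans Finset.sdiff_subset, ?_⟩
    intro e he
    rcases Finset.mem_union.1 he with h3 | h3
    · rcases Finset.mem_union.1 (Finset.mem_sdiff.1 (h2 h3)).1 with h4 | h4
      · exact mem_freeE.2 (Or.inr (Finset.mem_filter.1 (Finset.mem_inter.1 h4).2).1)
      · exact mem_freeE.2 (Or.inr (Finset.mem_sdiff.1 h4).1)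
    · exact mem_freeE.2 (Or.inr (Finset.mem_filter.1 (Finset.mem_inter.1 h3).2).1)
  · intro e he
    rcases Finset.mem_union.1 he with h3 | h3
    · exact (Finset.mem_sdiff.1 (h2 h3)).1
    · exact Finset.mem_union.2 (Or.inl h3)

/-- The shift of the cube complement is the group complement of the shift. -/
lemma groupShift_cornerDual {d r s : V} {ρ : Config E} {x z : Finset (Finset V) × Finset E} :
    groupShift ends d r s ρ x (cornerDual ends d r s ρ x z) =
      groupDual ends d r s ρ x (groupShift ends d r s ρ x z) := by
  simp only [groupShift, cornerDual, groupDual, groupCorner]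
  ext1
  · rfl
  · simp only
    ext e
    simp only [Finset.mem_union, Finset.mem_sdiff, not_or]
    tauto

/-- Every member of the group interval is the shift of a cube vector. -/
lemma exists_groupShift_eq {d r s : V} {ρ : Config E} {x y : Finset (Finset V) × Finset E}
    (hy : y ∈ groupInterval ends d r s ρ x) :
    (y.1, y.2 \ (groupLo ends d r s ρ x).2) ≤ groupCorner ends d r s ρ x ∧
      groupShift ends d r s ρ x (y.1, y.2 \ (groupLo ends d r s ρ x).2) = y := by
  obtain ⟨_, hlo, hhi⟩ := mem_groupInterval.1 hy
  refine ⟨⟨hhi.1, Finset.sdiff_subset_sdiff hhi.2 le_rfl⟩, ?_⟩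
  simp only [groupShift]
  ext1
  · rfl
  · simp only
    exact Finset.sdiff_union_of_subset hlo.2

/-- The shift is injective on the cube. -/
lemma groupShift_injOn {d r s : V} {ρ : Config E} {x z z' : Finset (Finset V) × Finset E}
    (hz : z ≤ groupCorner ends d r s ρ x) (hz' : z' ≤ groupCorner ends d r s ρ x)
    (h : groupShift ends d r s ρ x z = groupShift ends d r s ρ x z') : z = z' := by
  simp only [groupShift, Prod.mk.injEq] at h
  obtain ⟨h1, h2⟩ := h
  have hz2 : z.2 ∩ (groupLo ends d r s ρ x).2 = ∅ :=
    Finset.disjoint_iff_inter_eq_empty.1 (Finset.disjoint_of_subset_left hz.2 Finset.sdiff_disjoint)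
  have hz2' : z'.2 ∩ (groupLo ends d r s ρ x).2 = ∅ :=
    Finset.disjoint_iff_inter_eq_empty.1 (Finset.disjoint_of_subset_left hz'.2 Finset.sdiff_disjoint)
  ext1
  · exact h1
  · have : z.2 = (z.2 ∪ (groupLo ends d r s ρ x).2) \ (groupLo ends d r s ρ x).2 := by
      rw [Finset.union_sdiff_right, Finset.sdiff_eq_self_iff_disjoint.2
        (Finset.disjoint_iff_inter_eq_empty.2 hz2)]
    have this' : z'.2 = (z'.2 ∪ (groupLo ends d r s ρ x).2) \ (groupLo ends d r s ρ x).2 := by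
      rw [Finset.union_sdiff_right, Finset.sdiff_eq_self_iff_disjoint.2
        (Finset.disjoint_iff_inter_eq_empty.2 hz2')]
    rw [this, this', h2]

omit [Fintype V] in
/-- The shift is monotone. -/
lemma groupShift_mono {d r s : V} {ρ : Config E} {x z z' : Finset (Finset V) × Finset E}
    (h : z ≤ z') : groupShift ends d r s ρ x z ≤ groupShift ends d r s ρ x z' :=
  ⟨h.1, Finset.union_subset_union h.2 le_rfl⟩

/-- **The tilt on a group interval**: `Σ_{region} σ̃_pq ≤ 0` for the group of a `Sep`, `K`-side
point. -/
theorem groupRegion_sum_nonpos {p q r s d : V} (hr : d ≠ r) (hs : d ≠ s) (hpd : p ≠ d)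
    (hqd : q ≠ d) {ρ : Config E} (hρ : ρ ∈ RepP ends p q r s d)
    {x : Finset (Finset V) × Finset E} (hx : x ∈ cubeP ends d r s ρ)
    (hsepx : sep2 ends p q r s (assignX ends x ρ)) (hKx : d ∈ K2 ends r s (assignX ends x ρ)) :
    ∑ y ∈ groupRegion ends p q r s d ρ x, sigma (endsD ends d) (assignX ends y ρ) p q ≤ 0 := by
  obtain ⟨hρD, _⟩ := mem_RepP.1 hρ
  set c := groupCorner ends d r s ρ x with hc
  set ι := groupShift ends d r s ρ x with hι
  set κ := cornerDual ends d r s ρ x with hκ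
  set reg := groupRegion ends p q r s d ρ x with hreg
  have hκc : ∀ z, z ≤ c → κ z ≤ c := fun z _ => ⟨Finset.sdiff_subset, Finset.sdiff_subset⟩
  have hκκ : ∀ z, z ≤ c → κ (κ z) = z := by
    intro z hz
    simp only [hκ, cornerDual]
    ext1
    · exact Finset.sdiff_sdiff_eq_self hz.1
    · exact Finset.sdiff_sdiff_eq_self hz.2
  have hκanti : AntitoneOn κ (Set.Iic c) := fun z _ z' _ hzz' =>
    ⟨Finset.sdiff_subset_sdiff le_rfl hzz'.1, Finset.sdiff_subset_sdiff le_rfl hzz'.2⟩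
  have hιmem : ∀ z, z ≤ c → ι z ∈ groupInterval ends d r s ρ x :=
    fun z hz => groupShift_mem_groupInterval hx hz
  have hικ : ∀ z, ι (κ z) = groupDual ends d r s ρ x (ι z) := fun z => groupShift_cornerDual
  have key := HarrisCube.sum_sub_comp_mul_nonneg c (κ := κ) hκc hκκ hκanti
    (f := fun z => yInd ends p q d ρ (ι z))
    (h := fun z => if ι (κ z) ∈ reg then 1 else 0)
    (fun z _ => yInd_nonneg ρ _) (fun z _ => by split_ifs <;> norm_num) ?_ ?_
  · have hre := HarrisCube.sum_comp_involution c (κ := κ) hκc hκκ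
      (fun z => (yInd ends p q d ρ (ι z) - yInd ends p q d ρ (ι (κ z))) *
        (if ι (κ z) ∈ reg then 1 else 0))
    have hsimp : ∀ z ∈ HarrisCube.cube c,
        (yInd ends p q d ρ (ι (κ z)) - yInd ends p q d ρ (ι (κ (κ z)))) *
          (if ι (κ (κ z)) ∈ reg then 1 else 0) =
        - ((yInd ends p q d ρ (ι z) - yInd ends p q d ρ (ι (κ z))) *
          (if ι z ∈ reg then 1 else 0)) := by
      intro z hz
      rw [hκκ z (HarrisCube.mem_cube.1 hz)]
      ring
    rw [Finset.sum_congr rfl hsimp, Finset.sum_neg_distrib] at hre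
    have h2 : ∑ z ∈ HarrisCube.cube c, (yInd ends p q d ρ (ι z) - yInd ends p q d ρ (ι (κ z))) *
        (if ι z ∈ reg then 1 else 0) ≤ 0 := by linarith
    calc ∑ y ∈ reg, sigma (endsD ends d) (assignX ends y ρ) p q
        ≤ ∑ y ∈ reg, (yInd ends p q d ρ y - yInd ends p q d ρ (groupDual ends d r s ρ x y)) :=
          Finset.sum_le_sum (fun y hy =>
            sigma_endsD_le_sub_groupDual hr hs hρ hx hsepx hKx (mem_groupRegion.1 hy).1)
      _ = ∑ z ∈ (HarrisCube.cube c).filter (fun z => ι z ∈ reg),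
            (yInd ends p q d ρ (ι z) - yInd ends p q d ρ (ι (κ z))) := by
          refine Finset.sum_nbij' (fun y => (y.1, y.2 \ (groupLo ends d r s ρ x).2)) ι ?_ ?_ ?_ ?_ ?_
          · intro y hy
            obtain ⟨h1, h2⟩ := exists_groupShift_eq (mem_groupRegion.1 hy).1
            refine Finset.mem_filter.2 ⟨HarrisCube.mem_cube.2 h1, ?_⟩
            rw [hι, h2]
            exact hy
          · intro z hz
            exact (Finset.mem_filter.1 hz).2
          · intro y hy
            exact (exists_groupShift_eq (mem_groupRegion.1 hy).1).2
          · intro z hz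
            have hzc := HarrisCube.mem_cube.1 (Finset.mem_filter.1 hz).1
            obtain ⟨h1, h2⟩ := exists_groupShift_eq (hιmem z hzc)
            exact groupShift_injOn h1 hzc h2
          · intro y hy
            obtain ⟨h1, h2⟩ := exists_groupShift_eq (mem_groupRegion.1 hy).1
            rw [hικ, hι, h2]
      _ = ∑ z ∈ HarrisCube.cube c, (yInd ends p q d ρ (ι z) - yInd ends p q d ρ (ι (κ z))) *
            (if ι z ∈ reg then 1 else 0) := by
          rw [Finset.sum_filter]
          refine Finset.sum_congr rfl fun z _ => ?_
          split_ifs <;> simp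
      _ ≤ 0 := h2
  · -- `yInd ∘ ι` is monotone on the cube
    intro z hz z' hz' hzz'
    have hz1 := mem_cubeP_of_mem_groupInterval (hιmem z hz)
    have hz1' := mem_cubeP_of_mem_groupInterval (hιmem z' hz')
    obtain ⟨hT, hF⟩ := mem_cubeP.1 hz1
    simp only [yInd]
    split_ifs with h1 h2
    · exact le_rfl
    · exfalso
      apply h2
      exact conn_endsD_assignX_mono hr hs hρ (groupShift_mono hzz') hz1 hz1'
        (not_mem_K2_of_sep2 (sep2_endsD_assignX' hr hs hρD hT hF)).1 h1
    · norm_num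
    · exact le_rfl
  · -- the indicator of the region composed with the complement is monotone on the cube
    intro z hz z' hz' hzz'
    dsimp only
    split_ifs with h1 h2
    · exact le_rfl
    · exfalso
      apply h2
      refine mem_groupRegion.2 ⟨hιmem _ (hκc z' hz'), ?_⟩
      exact hdKY_anti_of_mem_groupInterval hr hs hpd hqd hρ hx hsepx hKx (hιmem _ (hκc z' hz'))
        (hιmem _ (hκc z hz)) (groupShift_mono (hκanti hz hz' hzz')) (mem_groupRegion.1 h1).2
    · norm_num
    · exact le_rfl

/-- The group interval is constant on itself. -/
lemma groupInterval_eq_of_mem {p q r s d : V} {ρ : Config E} (hρ : ρ ∈ RepD ends p q r s d)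
    {x y : Finset (Finset V) × Finset E} (hx : x ∈ cubeP ends d r s ρ)
    (hy : y ∈ groupInterval ends d r s ρ x) :
    groupInterval ends d r s ρ y = groupInterval ends d r s ρ x := by
  have hP := pocketY_eq_of_mem_groupInterval hρ hx hy
  have hEZ : EZ ends d r s ρ y = EZ ends d r s ρ x := by
    simp only [EZ, hP]
  have hfix : fixedBlocks ends d r s ρ y = fixedBlocks ends d r s ρ x := by
    simp only [fixedBlocks, hP]
  have hlo : groupLo ends d r s ρ y = groupLo ends d r s ρ x := by
    simp only [groupLo, hEZ]
    rw [inter_EZ_eq_of_mem_groupInterval hy]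
  have hhi : groupHi ends d r s ρ y = groupHi ends d r s ρ x := by
    simp only [groupHi, hEZ, hfix]
    rw [inter_EZ_eq_of_mem_groupInterval hy]
  simp only [groupInterval, hlo, hhi]

/-- The region is constant on the group interval. -/
lemma groupRegion_eq_of_mem {p q r s d : V} {ρ : Config E} (hρ : ρ ∈ RepD ends p q r s d)
    {x y : Finset (Finset V) × Finset E} (hx : x ∈ cubeP ends d r s ρ)
    (hy : y ∈ groupInterval ends d r s ρ x) :
    groupRegion ends p q r s d ρ y = groupRegion ends p q r s d ρ x := by
  simp only [groupRegion, groupInterval_eq_of_mem hρ hx hy]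

/-- **The `K`-side `HD ∧ r ~_Y s` part of the cube of a representative has non-positive
`σ̃_pq`-sum**: the cube is fibred by the group regions, each `≤ 0`. -/
theorem hdKY_cube_sum_nonpos {p q r s d : V} (hr : d ≠ r) (hs : d ≠ s) (hpd : p ≠ d)
    (hqd : q ≠ d) {ρ : Config E} (hρ : ρ ∈ RepP ends p q r s d) :
    ∑ x ∈ (cubeP ends d r s ρ).filter (fun x => HD ends p q r s d (assignX ends x ρ) ∧
        d ∈ K2 ends r s (assignX ends x ρ) ∧ Conn ends (assignX ends x ρ) r s),
      sigma (endsD ends d) (assignX ends x ρ) p q ≤ 0 := by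
  obtain ⟨hρD, _⟩ := mem_RepP.1 hρ
  set S := (cubeP ends d r s ρ).filter (fun x => HD ends p q r s d (assignX ends x ρ) ∧
    d ∈ K2 ends r s (assignX ends x ρ) ∧ Conn ends (assignX ends x ρ) r s) with hS
  -- a member of `S` is a `Sep`, `DOne`, `K`-side point and lies in its own group interval
  have hself : ∀ x ∈ S, x ∈ groupInterval ends d r s ρ x := by
    intro x hx
    obtain ⟨hxc, hHD, hK, _⟩ := Finset.mem_filter.1 hx
    obtain ⟨_, _, hone⟩ := hd_iff.1 hHD
    obtain ⟨_, hD, _, _⟩ := hHD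
    have hM : d ∉ M2 ends r s (assignX ends x ρ) := by
      rcases hone with ⟨_, hM, _⟩ | ⟨_, hK', _⟩
      · exact hM
      · exact absurd hK hK'
    exact self_mem_groupInterval_of_K hr hs hρ hxc hK hM hD
  have hmaps : ∀ x ∈ S, groupRegion ends p q r s d ρ x ∈
      S.image (groupRegion ends p q r s d ρ) := fun x hx => Finset.mem_image_of_mem _ hx
  rw [← Finset.sum_fiberwise_of_maps_to hmaps]
  refine Finset.sum_nonpos fun I hI => ?_
  obtain ⟨x₀, hx₀, rfl⟩ := Finset.mem_image.1 hI
  obtain ⟨hx₀c, hHD₀, hK₀, _⟩ := Finset.mem_filter.1 hx₀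
  obtain ⟨hsep₀, _, _, _⟩ := hHD₀
  have hfib : S.filter (fun x => groupRegion ends p q r s d ρ x = groupRegion ends p q r s d ρ x₀) =
      groupRegion ends p q r s d ρ x₀ := by
    ext y
    constructor
    · intro hy
      obtain ⟨hyS, hyeq⟩ := Finset.mem_filter.1 hy
      rw [← hyeq]
      exact mem_groupRegion.2 ⟨hself y hyS, (Finset.mem_filter.1 hyS).2⟩
    · intro hy
      obtain ⟨hyI, hyP⟩ := mem_groupRegion.1 hy
      refine Finset.mem_filter.2 ⟨Finset.mem_filter.2 ⟨mem_cubeP_of_mem_groupInterval hyI, hyP⟩, ?_⟩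
      exact groupRegion_eq_of_mem hρD hx₀c hyI
  rw [hfib]
  exact groupRegion_sum_nonpos hr hs hpd hqd hρ hx₀c hsep₀ hK₀

end Tilt

section C7

variable [Fintype V] [DecidableEq V] [Fintype E] [DecidableEq E] {ends : E → Sym2 V}
  {p q r s d : V}

/-- **The `K`-side `Y_rs`-sum is non-positive**: the lemma (L2) of class C7. -/
theorem hdKYSum_nonpos (hr : d ≠ r) (hs : d ≠ s) (hpd : p ≠ d) (hqd : q ≠ d) :
    hdKYSum ends p q r s d ≤ 0 := by
  have h1 : hdKYSum ends p q r s d = ∑ ω ∈ DOneSet ends p q r s d,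
      (if HD ends p q r s d ω ∧ d ∈ K2 ends r s ω ∧ Conn ends ω r s then sigma ends ω p q
        else 0) := by
    unfold hdKYSum DOneSet
    rw [Finset.sum_filter]
    refine Finset.sum_congr rfl fun ω _ => ?_
    by_cases h : sep2 ends p q r s ω ∧ DOne ends r s d ω
    · simp [h]
    · have h' : ¬ (HD ends p q r s d ω ∧ d ∈ K2 ends r s ω ∧ Conn ends ω r s) :=
        fun h' => h ⟨h'.1.1, h'.1.2.1⟩
      simp [h, h']
  rw [h1, sum_dOne_eq_sum_repP_legalP hr hs]
  refine Finset.sum_nonpos fun ρ hρ => ?_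
  have h2 : ∑ x ∈ LegalP ends p q r s d ρ,
      (if HD ends p q r s d (assignX ends x ρ) ∧ d ∈ K2 ends r s (assignX ends x ρ) ∧
          Conn ends (assignX ends x ρ) r s then sigma ends (assignX ends x ρ) p q else 0) =
      ∑ x ∈ (cubeP ends d r s ρ).filter (fun x => HD ends p q r s d (assignX ends x ρ) ∧
          d ∈ K2 ends r s (assignX ends x ρ) ∧ Conn ends (assignX ends x ρ) r s),
        sigma ends (assignX ends x ρ) p q := by
    rw [← Finset.sum_filter]
    refine Finset.sum_congr ?_ fun _ _ => rfl
    ext x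
    simp only [Finset.mem_filter, mem_LegalP, mem_DOneSet]
    constructor
    · rintro ⟨⟨hc, _⟩, h⟩
      exact ⟨hc, h⟩
    · rintro ⟨hc, h⟩
      exact ⟨⟨hc, h.1.1, h.1.2.1⟩, h⟩
  rw [h2]
  refine le_trans (Finset.sum_le_sum fun x hx => ?_) (hdKY_cube_sum_nonpos hr hs hpd hqd hρ)
  obtain ⟨_, hHD, hK, _⟩ := Finset.mem_filter.1 hx
  obtain ⟨_, _, hone⟩ := hd_iff.1 hHD
  obtain ⟨hsep, _, _, _⟩ := hHD
  have hM : d ∉ M2 ends r s (assignX ends x ρ) := by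
    rcases hone with ⟨_, hM, _⟩ | ⟨_, hK', _⟩
    · exact hM
    · exact absurd hK hK'
  rw [sigma_eq_endsD_add (d := d) hsep, if_pos hK, if_neg hM]
  have := eW_nonneg (ends := ends) (d := d) (p := p) (q := q) (assignX ends x ρ)
  linarith

/-- **CLASS C7.**  If every `r–s` path avoiding `d` passes through a neighbour of `d`
(`Linked`), then `dSignSum ends p q r s d ≤ 0`. -/
theorem dSignSum_nonpos_of_linked (hL : Linked ends r s d) (hr : r ≠ d) (hs : s ≠ d)
    (hpd : p ≠ d) (hqd : q ≠ d) : dSignSum ends p q r s d ≤ 0 :=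
  dSignSum_nonpos_of_hdKYSum_nonpos hL hr hs (hdKYSum_nonpos hr.symm hs.symm hpd hqd)

end C7


end NoPocket

end Summit.Ventures.PercRepro2
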